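import Literature.NumberTheory.LFunctions.BCHCrossTermExpansion
import Literature.Analysis.Fourier.LogPhaseIntegralSharp
import HarnessLib

/-!
# The cross term of the BCH mean square: stationary phase for every quadruple

Topic `Literature/NumberTheory/LFunctions`. Everything in this file is PROVED (no named facts; the only
definitions are the transparent abbreviations `BCH.crossFreq`, `BCH.crossAct`, `BCH.crossMain`,
`BCH.crossErr` for the frequency, activation time, stationary-phase main term and error of a quadruple).

`Literature/NumberTheory/LFunctions/BCHCrossTermExpansion.lean` writes the cross term of the
Balasubramanian–Conrey–Heath-Brown mean square (named fact
`Literature.Barriers.RiemannHypothesis.BalasubramanianConreyHeathBrown1985_meanSquare`) as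
`C = e^{-iπ/4} Σ_{h,k ≤ N} a_h ā_k (hk)^{-1/2} Σ_{μ,ν ≤ X} (μν)^{-1/2} J(h,k,μ,ν)` with the activated
log-phase integrals `J = ∫_T^{T'} [θ ≤ t] e^{it log(t/(ec))} dt`, `c = 2πμνh/k`, `θ = max(2πμ², 2πν²)`.
Here every `J` is evaluated by the sharp stationary-phase lemma of the tree
(`Literature.Analysis.Fourier.norm_logPhaseIntegral_sub_indicator_main_le_sharp`, Levinson 1974,
Lemmas 3.3–3.4) on `[max(T, θ), T']` (this needs `T' ≤ 2T`): main term
`[max(T,θ) ≤ c ≤ T'] 𝔣 e^{-ic} c^{1/2}`, error `275 + 32(4T₁/(|c − T₁| + √(2T₁)) + 4T₁/(|T' − c| + √(2T₁)))`,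
`T₁ = max(T, θ)`.

* `BCH.crossIntegral_eq` — `J = [θ ≤ T'] ∫_{max(T,θ)}^{T'} e^{it log(t/(ec))} dt`;
* `BCH.norm_crossIntegral_sub_crossMain_le` — `‖J − crossMain‖ ≤ crossErr` for one quadruple;
* `BCH.norm_crossTerm_sub_mainSum_le` — **the cross term is its stationary-phase main sum up to the
  weighted error sum**:
  `‖C − e^{-iπ/4} Σ_{h,k} a_h ā_k (hk)^{-1/2} Σ_{μ,ν} (μν)^{-1/2} crossMain‖`
  `  ≤ Σ_{h,k} Σ_{μ,ν} |a_h||a_k| (hk)^{-1/2} (μν)^{-1/2} crossErr`.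
  The weighted error sum is `O(B²(X N + √T N log³ T))` (the tail sums of `BCHTailSums.lean`; sibling
  file), and the main sum is evaluated arithmetically (geometric sums in `ν`, lattice points under a
  hyperbola for `k' ∣ μ`).

## References

* [Levinson1974] N. Levinson, Adv. Math. 13 (1974), §3, Lemmas 3.3–3.4 (stationary phase with `O(1)`
  interior error), §§4–5 (its use quadruple by quadruple).
* [Titchmarsh1986] E. C. Titchmarsh, *The Theory of the Riemann Zeta-Function*, 2nd ed. (1986), §9.22.
-/

noncomputable section

open Finset Real Complex MeasureTheory Set intervalIntegral
open scoped ComplexConjugate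
open Literature.Analysis.Fourier

namespace Literature.NumberTheory.LFunctions.BCH

open Literature.NumberTheory.LFunctions.TwistedMoment

/-! ### The players of one quadruple -/

/-- The stationary point `c = 2πμνh/k` of the quadruple `(h, k, μ, ν)`. [cite: Titchmarsh1986, §9.22] -/
def crossFreq (h k μ ν : ℕ) : ℝ := 2 * π * μ * ν * h / k

/-- The activation time `θ = max(2πμ², 2πν²)` of the pair `(μ, ν)`. [folklore] -/
def crossAct (μ ν : ℕ) : ℝ := max (2 * π * (μ : ℝ) ^ 2) (2 * π * (ν : ℝ) ^ 2)

/-- The stationary-phase main term of a quadruple on `[T, T']`: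
`[max(T, θ) ≤ c ≤ T'] · 𝔣 e^{-ic} c^{1/2}`. [cite: Levinson1974, Lemma 3.3] -/
def crossMain (T T' : ℝ) (h k μ ν : ℕ) : ℂ :=
  if max T (crossAct μ ν) ≤ crossFreq h k μ ν ∧ crossFreq h k μ ν ≤ T' then
    Literature.Analysis.Fourier.fresnelC * cexp (-I * crossFreq h k μ ν) *
      (Real.sqrt (crossFreq h k μ ν) : ℂ) else 0

/-- The stationary-phase error of a quadruple on `[T, T']`, `T₁ = max(T, θ)`:
`[θ ≤ T'] · (275 + 32(4T₁/(|c − T₁| + √(2T₁)) + 4T₁/(|T' − c| + √(2T₁))))`. [cite: Levinson1974, Lemma 3.4] -/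
def crossErr (T T' : ℝ) (h k μ ν : ℕ) : ℝ :=
  if crossAct μ ν ≤ T' then
    275 + 32 * (4 * max T (crossAct μ ν) / (|crossFreq h k μ ν - max T (crossAct μ ν)| +
        Real.sqrt (2 * max T (crossAct μ ν))) +
      4 * max T (crossAct μ ν) / (|T' - crossFreq h k μ ν| + Real.sqrt (2 * max T (crossAct μ ν))))
  else 0

/-- Unfolding `crossFreq`. [folklore] -/
theorem crossFreq_def (h k μ ν : ℕ) : crossFreq h k μ ν = 2 * π * μ * ν * h / k := rfl

/-- Unfolding `crossAct`. [folklore] -/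
theorem crossAct_def (μ ν : ℕ) : crossAct μ ν = max (2 * π * (μ : ℝ) ^ 2) (2 * π * (ν : ℝ) ^ 2) := rfl

/-- Unfolding `crossMain`. [folklore] -/
theorem crossMain_def (T T' : ℝ) (h k μ ν : ℕ) : crossMain T T' h k μ ν =
    if max T (crossAct μ ν) ≤ crossFreq h k μ ν ∧ crossFreq h k μ ν ≤ T' then
      Literature.Analysis.Fourier.fresnelC * cexp (-I * crossFreq h k μ ν) *
      (Real.sqrt (crossFreq h k μ ν) : ℂ) else 0 := rfl

/-- Unfolding `crossErr`. [folklore] -/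
theorem crossErr_def (T T' : ℝ) (h k μ ν : ℕ) : crossErr T T' h k μ ν =
    if crossAct μ ν ≤ T' then
      275 + 32 * (4 * max T (crossAct μ ν) / (|crossFreq h k μ ν - max T (crossAct μ ν)| +
          Real.sqrt (2 * max T (crossAct μ ν))) +
        4 * max T (crossAct μ ν) / (|T' - crossFreq h k μ ν| + Real.sqrt (2 * max T (crossAct μ ν))))
    else 0 := rfl

/-- `c > 0` for `h, k, μ, ν ≥ 1`. [folklore] -/
theorem crossFreq_pos {h k μ ν : ℕ} (hh : 0 < h) (hk : 0 < k) (hμ : 0 < μ) (hν : 0 < ν) :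
    0 < crossFreq h k μ ν := by
  rw [crossFreq_def]
  have : (0 : ℝ) < h := by exact_mod_cast hh
  have : (0 : ℝ) < k := by exact_mod_cast hk
  have : (0 : ℝ) < μ := by exact_mod_cast hμ
  have : (0 : ℝ) < ν := by exact_mod_cast hν
  positivity

/-- `θ ≥ 0`. [folklore] -/
theorem crossAct_nonneg (μ ν : ℕ) : 0 ≤ crossAct μ ν :=
  le_trans (by positivity) (le_max_left _ _)

/-- The error is non-negative. [folklore] -/
theorem crossErr_nonneg {T : ℝ} (hT : 0 < T) (T' : ℝ) (h k μ ν : ℕ) : 0 ≤ crossErr T T' h k μ ν := by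
  rw [crossErr_def]
  split_ifs
  · have : 0 < max T (crossAct μ ν) := lt_of_lt_of_le hT (le_max_left _ _)
    positivity
  · exact le_rfl

/-! ### One quadruple -/

/-- The activated integral of a quadruple is an ordinary log-phase integral from `max(T, θ)`:
`∫_T^{T'} [2πμ² ≤ t ∧ 2πν² ≤ t] e^{it log(t/(ec))} dt = [θ ≤ T'] ∫_{max(T,θ)}^{T'} e^{it log(t/(ec))} dt`.
[folklore] -/
theorem crossIntegral_eq {T T' : ℝ} (hTT' : T ≤ T') (h k μ ν : ℕ) :
    (∫ t in T..T', (if 2 * π * (μ : ℝ) ^ 2 ≤ t ∧ 2 * π * (ν : ℝ) ^ 2 ≤ t then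
        cexp (I * ((t * Real.log (t / (Real.exp 1 * (2 * π * μ * ν * h / k)))) : ℝ) : ℂ) else 0)) =
      if crossAct μ ν ≤ T' then
        ∫ t in max T (crossAct μ ν)..T',
          cexp (I * ((t * Real.log (t / (Real.exp 1 * crossFreq h k μ ν))) : ℝ) : ℂ) else 0 := by
  rw [integral_ite_and_le_eq _ hTT', crossAct_def, crossFreq_def]

/-- **Stationary phase for one quadruple.** For `0 < T ≤ T' ≤ 2T` and `h, k, μ, ν ≥ 1`:
`‖∫_T^{T'} [act] e^{it log(t/(ec))} dt − crossMain‖ ≤ crossErr`. [cite: Levinson1974, Lemma 3.4] -/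
theorem norm_crossIntegral_sub_crossMain_le {T T' : ℝ} (hT : 0 < T) (hTT' : T ≤ T') (hT'2 : T' ≤ 2 * T)
    {h k μ ν : ℕ} (hh : 0 < h) (hk : 0 < k) (hμ : 0 < μ) (hν : 0 < ν) :
    ‖(∫ t in T..T', (if 2 * π * (μ : ℝ) ^ 2 ≤ t ∧ 2 * π * (ν : ℝ) ^ 2 ≤ t then
        cexp (I * ((t * Real.log (t / (Real.exp 1 * (2 * π * μ * ν * h / k)))) : ℝ) : ℂ) else 0)) -
        crossMain T T' h k μ ν‖ ≤ crossErr T T' h k μ ν := by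
  rw [crossIntegral_eq hTT', crossMain_def, crossErr_def]
  have hc := crossFreq_pos hh hk hμ hν
  by_cases hact : crossAct μ ν ≤ T'
  · rw [if_pos hact, if_pos hact]
    have hT₁ : 0 < max T (crossAct μ ν) := lt_of_lt_of_le hT (le_max_left _ _)
    have hT₁T' : max T (crossAct μ ν) ≤ T' := max_le hTT' hact
    have hT'2' : T' ≤ 2 * max T (crossAct μ ν) := hT'2.trans (by linarith [le_max_left T (crossAct μ ν)])
    exact norm_logPhaseIntegral_sub_indicator_main_le_sharp hT₁ hT₁T' hT'2' hc
  · rw [if_neg hact, if_neg hact]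
    have hnot : ¬ (max T (crossAct μ ν) ≤ crossFreq h k μ ν ∧ crossFreq h k μ ν ≤ T') := by
      rintro ⟨h1, h2⟩
      exact hact ((le_max_right _ _).trans (h1.trans h2))
    rw [if_neg hnot, sub_zero, norm_zero]

/-! ### The whole cross term -/

/-- **The cross term is its stationary-phase main sum up to the weighted error sum.** For
`0 < T ≤ T' ≤ 2T`, `X = ⌊√(T'/2π)⌋`, `A = BCH.mollPoly a N`:
`‖∫_T^{T'} Θ²S_t²|A|² dt − e^{-iπ/4} Σ_{h,k ≤ N} a_h ā_k (hk)^{-1/2} Σ_{μ,ν ≤ X} (μν)^{-1/2} crossMain‖`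
`  ≤ Σ_{h,k ≤ N} Σ_{μ,ν ≤ X} |a_h| |a_k| (hk)^{-1/2} (μν)^{-1/2} crossErr`. [cite: Levinson1974, §5] -/
theorem norm_crossTerm_sub_mainSum_le (a : ℕ → ℂ) (N : ℕ) {T T' : ℝ} (hT : 0 < T) (hTT' : T ≤ T')
    (hT'2 : T' ≤ 2 * T) :
    ‖(∫ t in T..T', thetaMainPhase t ^ 2 * (mainSum ⌊Real.sqrt (t / (2 * π))⌋₊ t) ^ 2 *
        (((‖mollPoly a N t‖ ^ 2 : ℝ)) : ℂ)) -
      cexp (-(I * (π / 4 : ℝ))) * ∑ h ∈ Finset.Icc 1 N, ∑ k ∈ Finset.Icc 1 N,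
        a h * conj (a k) * ((((h : ℝ) * k) ^ (-(1 / 2 : ℝ)) : ℝ) : ℂ) *
          ∑ μ ∈ Finset.Icc 1 ⌊Real.sqrt (T' / (2 * π))⌋₊, ∑ ν ∈ Finset.Icc 1 ⌊Real.sqrt (T' / (2 * π))⌋₊,
            ((((μ : ℝ) * ν) ^ (-(1 / 2 : ℝ)) : ℝ) : ℂ) * crossMain T T' h k μ ν‖ ≤
      ∑ h ∈ Finset.Icc 1 N, ∑ k ∈ Finset.Icc 1 N, ∑ μ ∈ Finset.Icc 1 ⌊Real.sqrt (T' / (2 * π))⌋₊,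
        ∑ ν ∈ Finset.Icc 1 ⌊Real.sqrt (T' / (2 * π))⌋₊,
          ‖a h‖ * ‖a k‖ * ((h : ℝ) * k) ^ (-(1 / 2 : ℝ)) * ((μ : ℝ) * ν) ^ (-(1 / 2 : ℝ)) *
            crossErr T T' h k μ ν := by
  set X : ℕ := ⌊Real.sqrt (T' / (2 * π))⌋₊ with hX
  -- the activated integrals
  set J : ℕ → ℕ → ℕ → ℕ → ℂ := fun h k μ ν =>
    ∫ t in T..T', (if 2 * π * (μ : ℝ) ^ 2 ≤ t ∧ 2 * π * (ν : ℝ) ^ 2 ≤ t then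
        cexp (I * ((t * Real.log (t / (Real.exp 1 * (2 * π * μ * ν * h / k)))) : ℝ) : ℂ) else 0)
    with hJ
  rw [crossTerm_eq a N hT hTT' le_rfl]
  -- combine into one quadruple sum of differences
  have hcomb : cexp (-(I * (π / 4 : ℝ))) * ∑ h ∈ Finset.Icc 1 N, ∑ k ∈ Finset.Icc 1 N,
        a h * conj (a k) * ((((h : ℝ) * k) ^ (-(1 / 2 : ℝ)) : ℝ) : ℂ) *
          ∑ μ ∈ Finset.Icc 1 X, ∑ ν ∈ Finset.Icc 1 X, ((((μ : ℝ) * ν) ^ (-(1 / 2 : ℝ)) : ℝ) : ℂ) * J h k μ ν -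
      cexp (-(I * (π / 4 : ℝ))) * ∑ h ∈ Finset.Icc 1 N, ∑ k ∈ Finset.Icc 1 N,
        a h * conj (a k) * ((((h : ℝ) * k) ^ (-(1 / 2 : ℝ)) : ℝ) : ℂ) *
          ∑ μ ∈ Finset.Icc 1 X, ∑ ν ∈ Finset.Icc 1 X,
            ((((μ : ℝ) * ν) ^ (-(1 / 2 : ℝ)) : ℝ) : ℂ) * crossMain T T' h k μ ν =
      cexp (-(I * (π / 4 : ℝ))) * ∑ h ∈ Finset.Icc 1 N, ∑ k ∈ Finset.Icc 1 N,
        ∑ μ ∈ Finset.Icc 1 X, ∑ ν ∈ Finset.Icc 1 X,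
          a h * conj (a k) * ((((h : ℝ) * k) ^ (-(1 / 2 : ℝ)) : ℝ) : ℂ) *
            (((((μ : ℝ) * ν) ^ (-(1 / 2 : ℝ)) : ℝ) : ℂ) * (J h k μ ν - crossMain T T' h k μ ν)) := by
    rw [← mul_sub, ← Finset.sum_sub_distrib]
    congr 1
    refine Finset.sum_congr rfl fun h _ => ?_
    rw [← Finset.sum_sub_distrib]
    refine Finset.sum_congr rfl fun k _ => ?_
    rw [← mul_sub, ← Finset.sum_sub_distrib, Finset.mul_sum]
    refine Finset.sum_congr rfl fun μ _ => ?_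
    rw [← Finset.sum_sub_distrib, Finset.mul_sum]
    refine Finset.sum_congr rfl fun ν _ => ?_
    ring
  rw [hcomb, norm_mul]
  have hphase : ‖cexp (-(I * (π / 4 : ℝ)))‖ = 1 := by
    rw [show -(I * ((π / 4 : ℝ) : ℂ)) = ((-(π / 4) : ℝ) : ℂ) * I by push_cast; ring,
      Complex.norm_exp_ofReal_mul_I]
  rw [hphase, one_mul]
  -- termwise
  refine (norm_sum_le _ _).trans (Finset.sum_le_sum fun h hh => ?_)
  refine (norm_sum_le _ _).trans (Finset.sum_le_sum fun k hk => ?_)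
  refine (norm_sum_le _ _).trans (Finset.sum_le_sum fun μ hμ => ?_)
  refine (norm_sum_le _ _).trans (Finset.sum_le_sum fun ν hν => ?_)
  have hh0 : 0 < h := (Finset.mem_Icc.1 hh).1
  have hk0 : 0 < k := (Finset.mem_Icc.1 hk).1
  have hμ0 : 0 < μ := (Finset.mem_Icc.1 hμ).1
  have hν0 : 0 < ν := (Finset.mem_Icc.1 hν).1
  have hone := norm_crossIntegral_sub_crossMain_le hT hTT' hT'2 hh0 hk0 hμ0 hν0
  have hhk0 : 0 ≤ ((h : ℝ) * k) ^ (-(1 / 2 : ℝ)) := Real.rpow_nonneg (by positivity) _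
  have hμν0 : 0 ≤ ((μ : ℝ) * ν) ^ (-(1 / 2 : ℝ)) := Real.rpow_nonneg (by positivity) _
  rw [norm_mul, norm_mul, norm_mul, norm_mul, Complex.norm_conj, Complex.norm_real, Complex.norm_real,
    Real.norm_of_nonneg hhk0, Real.norm_of_nonneg hμν0]
  have : ‖J h k μ ν - crossMain T T' h k μ ν‖ ≤ crossErr T T' h k μ ν := hone
  calc ‖a h‖ * ‖a k‖ * ((h : ℝ) * k) ^ (-(1 / 2 : ℝ)) *
        (((μ : ℝ) * ν) ^ (-(1 / 2 : ℝ)) * ‖J h k μ ν - crossMain T T' h k μ ν‖)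
      ≤ ‖a h‖ * ‖a k‖ * ((h : ℝ) * k) ^ (-(1 / 2 : ℝ)) *
          (((μ : ℝ) * ν) ^ (-(1 / 2 : ℝ)) * crossErr T T' h k μ ν) := by
        gcongr
    _ = _ := by ring

end Literature.NumberTheory.LFunctions.BCH
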